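import Summits.CriticalPhenomena.CardyFormulaZ2.Theorems.CardyIKTransportIKMixedBoxCrossingTransportStubCylPlaneGeom
import Summits.CriticalPhenomena.CardyFormulaZ2.Theorems.CardyIKTransportIKMixedBoxCrossingDefectStubBridgeLaw

/-!
# Stub `stub_cylPlane` (line `defect-closure-exploration`, crux `IKMixedBoxCrossing`, stmt-CriticalPhenomena-5911) —
# helper 5: a band crossing of the slab is a bottom–top crossing of the PLANAR BOX

Support file (`--supports stmt-CriticalPhenomena-5911`) for the registered stub `stub_cylPlane : CylPlane`.

A black path of the slab inside the band of rows `0 … h` (`CylPlane.Band0 w L (h+1)`, helper 4) is, read through the band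
extraction `CylPlane.bandQ L h` (helper 2), a black bottom–top crossing `tbCross 0 0 (w+1) (h+1)` of the planar box
`[0, w+1) × [0, h+1)` for the OBSERVABLES `obsQ` of a box configuration (black cells `site p`; anti-diagonal on the inner faces with
flag `true`, main diagonal everywhere else): every clause of `cylGraph` inside the band is a clause of `blackEdges` (`clause_of_rel`),
so the band graph maps homomorphically into the open graph of the box (`band0_subset_tb`; `h + 1 < L` keeps the band from
wrapping around the cylinder).
-/

noncomputable section

namespace Summit.CriticalPhenomena.CardyFormulaZ2.Cruxes.IKMixedBoxCrossing.DefectClosureExploration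

open scoped BigOperators Classical
open Finset
open Literature.Probability.Percolation Literature.Probability.LatticeModels
open Summit.CriticalPhenomena.CardyFormulaZ2.Theorems.IKLinearTransport.PinnedDiagramExchange (Obs blackEdges tbCross)
open Summit.CriticalPhenomena.CardyFormulaZ2.Theorems.IKLinearTransport.PinnedDiagramExchange.CouplingToLimits
  (mk_mem_blackEdges_iff)
open BridgeLawStub (site site_injective site_apply_zero site_apply_one)

namespace CylPlane

variable {w L : ℕ}

section Planar

variable {h : ℕ}

/-- OBSERVABLES of a planar box configuration: the black cells `site p`, `q.1 p = true`, and the anti-diagonal faces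
`site (inner face)`, flag `true` (all other faces of `ℤ²` carry the main diagonal; the box crossing never reads them). -/
def obsQ (q : Q w h) : Obs :=
  ({v | ∃ p : Fin (w + 1) × Fin (h + 1), site p = v ∧ q.1 p = true},
    {f | ∃ p : Fin w × Fin h, site (p.1.castSucc, p.2.castSucc) = f ∧ q.2 p = true})

/-- Black cells of the observables. -/
theorem site_mem_obsQ_fst {q : Q w h} {p : Fin (w + 1) × Fin (h + 1)} : site p ∈ (obsQ q).1 ↔ q.1 p = true := by
  simp only [obsQ, Set.mem_setOf_eq, site_injective.eq_iff, exists_eq_left]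

/-- Anti-diagonal faces of the observables. -/
theorem site_mem_obsQ_snd {q : Q w h} {p : Fin w × Fin h} :
    site (p.1.castSucc, p.2.castSucc) ∈ (obsQ q).2 ↔ q.2 p = true := by
  simp only [obsQ, Set.mem_setOf_eq]
  constructor
  · rintro ⟨p', hp', h'⟩
    have e := site_injective hp'
    simp only [Prod.mk.injEq, Fin.castSucc_inj] at e
    obtain ⟨e1, e2⟩ := e
    rw [← h']; exact congrArg q.2 (Prod.ext e1.symm e2.symm)
  · exact fun hq => ⟨p, rfl, hq⟩

/-- The planar BOTTOM–TOP crossing event of the box `[0, w+1) × [0, h+1)`, read on box configurations. -/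
def TBQ (w h : ℕ) : Set (Q w h) := {q | obsQ q ∈ tbCross 0 0 (w + 1) (h + 1)}

/-- The site of a cell of the band (row `val < h + 1`). -/
def bsite (z : Fin (w + 1) × ZMod L) (hz : z.2.val < h + 1) : Site 2 := site (z.1, (⟨z.2.val, hz⟩ : Fin (h + 1)))

/-- Coordinates of the band site. -/
theorem bsite_apply (z : Fin (w + 1) × ZMod L) (hz : z.2.val < h + 1) :
    bsite z hz 0 = ((z.1 : ℕ) : ℤ) ∧ bsite z hz 1 = ((z.2.val : ℕ) : ℤ) := ⟨rfl, rfl⟩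

variable [NeZero L] (y : CylCfg w L)

/-- A black band cell is a black cell of the observables of the band. -/
theorem bsite_black {z : Fin (w + 1) × ZMod L} (hz : y.1 z = true ∧ z.2.val < h + 1) :
    bsite z hz.2 ∈ (obsQ (bandQ L h y)).1 := by
  rw [bsite, site_mem_obsQ_fst]
  show y.1 (z.1, ((z.2.val : ℕ) : ZMod L)) = true
  rw [ZMod.natCast_zmod_val]; exact hz.1

/-- The flag of a band face read through the observables. -/
theorem bandQ_flag (j : Fin w) (r : ZMod L) (hr : r.val < h) :
    (site ((j.castSucc : Fin (w + 1)), (⟨r.val, by omega⟩ : Fin (h + 1))) ∈ (obsQ (bandQ L h y)).2) ↔ y.2 (j, r) = true := by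
  have e : site ((j.castSucc : Fin (w + 1)), (⟨r.val, by omega⟩ : Fin (h + 1))) =
      site (((j, (⟨r.val, hr⟩ : Fin h)) : Fin w × Fin h).1.castSucc, ((j, (⟨r.val, hr⟩ : Fin h)) : Fin w × Fin h).2.castSucc) := rfl
  rw [e, site_mem_obsQ_snd]
  show y.2 (j, ((r.val : ℕ) : ZMod L)) = true ↔ _
  rw [ZMod.natCast_zmod_val]

/-- One orientation of a black edge of the band is a clause of `blackEdges` of the observables. -/
theorem clause_of_rel (hL : h + 1 < L) {z z' : Fin (w + 1) × ZMod L} (hz : y.1 z = true ∧ z.2.val < h + 1)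
    (hz' : y.1 z' = true ∧ z'.2.val < h + 1)
    (hr : (z'.1 = z.1 ∧ z'.2 = z.2 + 1) ∨ (z'.1.val = z.1.val + 1 ∧ z'.2 = z.2) ∨
      (∃ j : Fin w, z.1 = j.castSucc ∧ z'.1 = j.succ ∧ z'.2 = z.2 + 1 ∧ y.2 (j, z.2) = false) ∨
      (∃ j : Fin w, z.1 = j.castSucc ∧ z'.1 = j.succ ∧ z.2 = z'.2 + 1 ∧ y.2 (j, z'.2) = true)) :
    bsite z hz.2 ∈ (obsQ (bandQ L h y)).1 ∧ bsite z' hz'.2 ∈ (obsQ (bandQ L h y)).1 ∧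
      (bsite z' hz'.2 = bsite z hz.2 + ![1, 0] ∨ bsite z' hz'.2 = bsite z hz.2 + ![0, 1] ∨
        (bsite z' hz'.2 = bsite z hz.2 + ![1, 1] ∧ ¬ bsite z hz.2 ∈ (obsQ (bandQ L h y)).2) ∨
        (bsite z' hz'.2 = bsite z hz.2 + ![1, -1] ∧ (bsite z hz.2 + ![0, -1]) ∈ (obsQ (bandQ L h y)).2)) := by
  refine ⟨bsite_black y hz, bsite_black y hz', ?_⟩
  have hzv := (bsite_apply z hz.2)
  have hz'v := (bsite_apply z' hz'.2)
  rcases hr with ⟨h1, h2⟩ | ⟨h1, h2⟩ | ⟨j, h1, h2, h3, h4⟩ | ⟨j, h1, h2, h3, h4⟩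
  · -- vertical
    have hv : z'.2.val = z.2.val + 1 := by rw [h2]; exact val_add_one z.2 (by omega)
    refine Or.inr (Or.inl (Contour.site_ext ?_ ?_)) <;>
      simp only [Pi.add_apply, Matrix.cons_val_zero, Matrix.cons_val_one, hzv.1, hzv.2, hz'v.1, hz'v.2, h1, hv] <;>
        push_cast <;> ring
  · -- horizontal
    refine Or.inl (Contour.site_ext ?_ ?_) <;>
      simp only [Pi.add_apply, Matrix.cons_val_zero, Matrix.cons_val_one, hzv.1, hzv.2, hz'v.1, hz'v.2, h1, h2] <;>
        push_cast <;> ring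
  · -- main diagonal of the face `(j, z.2)`, flag `false`
    have hv : z'.2.val = z.2.val + 1 := by rw [h3]; exact val_add_one z.2 (by omega)
    refine Or.inr (Or.inr (Or.inl ⟨Contour.site_ext ?_ ?_, fun hmem => ?_⟩))
    · simp only [Pi.add_apply, Matrix.cons_val_zero, hzv.1, hz'v.1, h1, h2, Fin.val_succ, Fin.val_castSucc]
      push_cast; ring
    · simp only [Pi.add_apply, Matrix.cons_val_zero, Matrix.cons_val_one, hzv.2, hz'v.2, hv]
      push_cast; ring
    · have e : bsite z hz.2 = site ((j.castSucc : Fin (w + 1)), (⟨z.2.val, by omega⟩ : Fin (h + 1))) := by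
        rw [bsite, h1]
      rw [e, bandQ_flag y j z.2 (by omega), h4] at hmem
      exact Bool.false_ne_true hmem
  · -- anti-diagonal of the face `(j, z'.2)`, flag `true`
    have hv : z.2.val = z'.2.val + 1 := by rw [h3]; exact val_add_one z'.2 (by omega)
    refine Or.inr (Or.inr (Or.inr ⟨Contour.site_ext ?_ ?_, ?_⟩))
    · simp only [Pi.add_apply, Matrix.cons_val_zero, hzv.1, hz'v.1, h1, h2, Fin.val_succ, Fin.val_castSucc]
      push_cast; ring
    · simp only [Pi.add_apply, Matrix.cons_val_zero, Matrix.cons_val_one, hzv.2, hz'v.2, hv]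
      push_cast; ring
    · have e : bsite z hz.2 + ![0, -1] = site ((j.castSucc : Fin (w + 1)), (⟨z'.2.val, by omega⟩ : Fin (h + 1))) := by
        refine Contour.site_ext ?_ ?_
        · simp only [Pi.add_apply, Matrix.cons_val_zero, hzv.1, h1, site_apply_zero]; ring
        · simp only [Pi.add_apply, Matrix.cons_val_one, hzv.2, hv, site_apply_one]; push_cast; ring
      rw [e, bandQ_flag y j z'.2 (by omega)]
      exact h4

/-- A black edge of the band is an open edge of `blackEdges` of the observables of the band. -/
theorem blackEdges_of_adj (hL : h + 1 < L) {z z' : Fin (w + 1) × ZMod L} (hz : y.1 z = true ∧ z.2.val < h + 1)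
    (hz' : y.1 z' = true ∧ z'.2.val < h + 1) (hadj : (cylGraph w L y.2).Adj z z') :
    (openGraph (blackEdges (obsQ (bandQ L h y)))).Adj (bsite z hz.2) (bsite z' hz'.2) := by
  rw [cylGraph, SimpleGraph.fromRel_adj] at hadj
  obtain ⟨hne, hr⟩ := hadj
  rw [openGraph_adj, mk_mem_blackEdges_iff]
  refine ⟨hr.imp (clause_of_rel y hL hz hz') (clause_of_rel y hL hz' hz), fun heq => hne ?_⟩
  have e := site_injective heq
  simp only [Prod.mk.injEq, Fin.mk.injEq] at e
  exact Prod.ext e.1 (ZMod.val_injective L e.2)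

/-- **A band crossing of the slab is a planar box crossing**: `Band0 w L (h+1) ⊆ bandQ L h ⁻¹' TBQ w h` (for `h + 1 < L`, so that
the band does not wrap around the cylinder). -/
theorem band0_subset_tb (hL : h + 1 < L) : Band0 w L (h + 1) ⊆ (bandQ L h : CylCfg w L → Q w h) ⁻¹' TBQ w h := by
  rintro y ⟨a, b, ha0, hb0, ha, hb, hreach⟩
  let ψ : ((cylGraph w L y.2).induce {z | y.1 z = true ∧ z.2.val < h + 1}) →g
      ((openGraph (blackEdges (obsQ (bandQ L h y)))).induce
        {v : Site 2 | 0 ≤ v 0 ∧ v 0 < 0 + ((w + 1 : ℕ) : ℤ) ∧ 0 ≤ v 1 ∧ v 1 < 0 + ((h + 1 : ℕ) : ℤ)}) :=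
    { toFun := fun z => ⟨bsite z.1 z.2.2, by
        refine ⟨?_, ?_, ?_, ?_⟩ <;> simp only [(bsite_apply z.1 z.2.2).1, (bsite_apply z.1 z.2.2).2] <;>
          [positivity; (have := z.1.1.isLt; push_cast; omega); positivity; (have := z.2.2; push_cast; omega)]⟩
      map_rel' := fun {z z'} hzz' => blackEdges_of_adj y hL z.2 z'.2 hzz' }
  refine ⟨bsite a ha.2, ⟨by rw [(bsite_apply a ha.2).2, ha0]; simp, by rw [(bsite_apply a ha.2).1]; positivity,
      by rw [(bsite_apply a ha.2).1]; have := a.1.isLt; push_cast; omega⟩,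
    bsite b hb.2, ⟨by rw [(bsite_apply b hb.2).2, hb0]; push_cast; omega, by rw [(bsite_apply b hb.2).1]; positivity,
      by rw [(bsite_apply b hb.2).1]; have := b.1.isLt; push_cast; omega⟩,
    (ψ ⟨a, ha⟩).2, (ψ ⟨b, hb⟩).2, hreach.map ψ⟩

end Planar

end CylPlane

/-- **Registered helper `cylPlane_band0_subset_tb`** (line `defect-closure-exploration`, stub `stub_cylPlane`, step (ii)/(iv) glue):
a black path of the slab inside the band of rows `0 … h` from row `0` to row `h` is, read on the band, a black bottom–top crossing
of the planar box `[0, w+1) × [0, h+1)`. -/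
theorem cylPlane_band0_subset_tb : ∀ {w L h : ℕ} [NeZero L], h + 1 < L →
    CylPlane.Band0 w L (h + 1) ⊆ (CylPlane.bandQ L h : CylCfg w L → CylPlane.Q w h) ⁻¹' CylPlane.TBQ w h :=
  fun hL => CylPlane.band0_subset_tb hL

end Summit.CriticalPhenomena.CardyFormulaZ2.Cruxes.IKMixedBoxCrossing.DefectClosureExploration

end
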